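import Literature.Combinatorics.Enumerative.AntidiagonalTupleCard
import Literature.RingTheory.Nullstellensatz.PerronTheorem
import HarnessLib

/-!
# Perron's degree bound for a coordinate over `n` polynomials of degree `≤ δ`: the `y₀`-degree
# `≤ δⁿ` by a dimension count (the form used in the Jacobian criterion of Beecken–Mittmann–Saxena)

Topic `Literature/RingTheory/Nullstellensatz` (next to the weak Perron theorem `PerronTheorem`).

M. Beecken, J. Mittmann, N. Saxena, *Algebraic independence and blackbox identity testing*
(Inform. and Comput. 222 (2013) = arXiv:1102.2789), **Thm. 4 (Perron's theorem)**: «Let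
`f_i ∈ K[x]` be a polynomial of degree `δ_i ≥ 1` for `i ∈ [n+1]`. Then there exists a non-zero
polynomial `F ∈ K[y_1, …, y_{n+1}]` such that `F(f_1, …, f_{n+1}) = 0` and
`deg(F) ≤ (∏_i δ_i) / min_i δ_i`», used in the proof of **Thm. 6 (the Jacobian criterion)**,
App. A: «there exist non-zero polynomials `F_i ∈ K[y_0, y_1, …, y_n]` … such that `deg_{y_0}(F_i) > 0`
and `F_i(x_i, f_1, …, f_r, x_{r+1}, …, x_n) = 0`. By Theorem 4 (with `(n−r+1)` of the `δ_i`'s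
being `1`), we have `deg(F_i) ≤ δ^r`. Hence, by the assumptions on `ch(K)`, we have
`∂_{y_0}F_i ≠ 0`.» What that argument consumes is the bound on the **`y_0`-degree** of a relation,
and this file PROVES that part by an elementary dimension count (no Bézout-type degree theory):

* `exists_relation_degreeOf_le_pow` — over any non-trivial commutative coefficient ring `A`, for
  `f_1, …, f_n ∈ A[x_1, …, x_n]` of total degree `≤ δ` (`δ ≥ 1`) and any coordinate `x_i`, there is
  a non-zero `F ∈ A[y_0, y_1, …, y_n]` with `F(x_i, f_1, …, f_n) = 0` and `deg_{y_0} F ≤ δ^n`.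
  (In Thm. 6's use, `A = K[x_{r+1}, …, x_n]` carries the remaining coordinates as coefficients and
  `n = r`; the printed `deg(F_i) ≤ δ^r` — total, weighted — is STRONGER than what is typed; the
  `y_0`-degree is the part Thm. 6's proof uses.)
* `exists_relation_degreeOf_le_pow_sum` — the same with the untouched coordinates as VARIABLES:
  for `f : σ → K[x_σ, x_τ]` of degree `≤ δ` and `i ∈ σ`, a non-zero `H ∈ K[y_0, y_σ, y_τ]` with
  `H(x_i, f, x_τ) = 0` and `deg_{y_0} H ≤ δ^{|σ|}` (transport along `K[x_σ, x_τ] ≅ K[x_τ][x_σ]`).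

Proof (Perron's count, kept sharp in the one direction that matters): the `A`-linear substitution
`F ↦ F(x_i, f)` maps the free module on the monomials `y_0^a y^b`, `a ≤ δ^n`, `|b| ≤ m` — of rank
`(δ^n + 1)·C(m+n, n)` (`card_optionIndexSet`) — into the polynomials of degree `≤ δ(δ^n + m)`, of
rank `C(δ(δ^n+m) + n, n)`; since `C(δ m + δ^{n+1} + n, n) < (δ^n+1)·C(m+n, n)` for an explicit
`m` (`exists_choose_lt`, from `(x+w)^{n} ≤ x^{n} + n w (x+w)^{n-1}`), the map has a kernel (strong
rank condition). Algebraic independence of the `f_j` is not needed.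

Honest framing: a lemma of commutative algebra in support of the val-lit NP corpus (FSV 2018
Fact 51 = [BMS13] Thm. 6 in positive characteristic); nothing here bears on `VP ≠ VNP`.

## References
* [BeeckenMittmannSaxena2013] M. Beecken, J. Mittmann, N. Saxena, arXiv:1102.2789, Thm. 4 and
  App. A (proof of Thm. 6). locator: paper:arxiv-1102.2789 p0005.txt:L31–L36 (Thm. 4), p0014.txt:L74–L86 (App. A, «deg(F_i) ≤ δ^r … ∂_{y_0}F_i ≠ 0»)
* [Ploski2005] A. Płoski, *Algebraic dependence of polynomials after O. Perron…*, Thm. 1.1.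
* [Perron1927] O. Perron, *Algebra I*, Satz 57.
-/

noncomputable section

open MvPolynomial Module Finset

namespace Literature.RingTheory.Nullstellensatz

/-! ### The numerical inequality -/

/-- `(x + w)^{n+1} ≤ x^{n+1} + (n+1)·w·(x+w)^n` (the first two terms of the binomial expansion
bound the rest). [folklore] -/
private theorem pow_add_le_pow_add_mul (x w n : ℕ) :
    (x + w) ^ (n + 1) ≤ x ^ (n + 1) + (n + 1) * w * (x + w) ^ n := by
  induction n with
  | zero => simp
  | succ n ih =>
    have hx : x ^ (n + 1) ≤ (x + w) ^ (n + 1) := Nat.pow_le_pow_left (Nat.le_add_right x w) _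
    calc (x + w) ^ (n + 2) = (x + w) ^ (n + 1) * (x + w) := pow_succ _ _
      _ ≤ (x ^ (n + 1) + (n + 1) * w * (x + w) ^ n) * (x + w) := Nat.mul_le_mul_right _ ih
      _ = x ^ (n + 2) + w * x ^ (n + 1) + (n + 1) * w * (x + w) ^ (n + 1) := by ring
      _ ≤ x ^ (n + 2) + w * (x + w) ^ (n + 1) + (n + 1) * w * (x + w) ^ (n + 1) := by
          gcongr
      _ = x ^ (n + 2) + (n + 2) * w * (x + w) ^ (n + 1) := by ring

/-- **The count.** If `δ ≥ 1` and `δ^r ≤ e` then `C(δ m + c + r, r) < (e + 1)·C(m + r, r)` for some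
`m` (explicitly `m = r c' (δ+1)^{r-1} + c'`, `c' = c + r`): the ratio of the two binomial
coefficients tends to `δ^r < e + 1`. [folklore] -/
private theorem exists_choose_lt {δ e : ℕ} (r c : ℕ) (hδ : 1 ≤ δ) (he : δ ^ r ≤ e) :
    ∃ m : ℕ, (δ * m + c + r).choose r < (e + 1) * (m + r).choose r := by
  cases r with
  | zero =>
    refine ⟨0, ?_⟩
    simp only [Nat.choose_zero_right, mul_one]
    simp only [pow_zero] at he
    omega
  | succ r =>
    set c' := c + (r + 1) with hc'
    set m := (r + 1) * c' * (δ + 1) ^ r + c' with hm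
    refine ⟨m, ?_⟩
    set M := m + 1 with hM
    -- `(r+1)! · C(m + r + 1, r + 1) = (m+1)(m+2)⋯(m+r+1) ≥ (m+1)^{r+1}`
    have h1 : (r + 1).factorial * (m + (r + 1)).choose (r + 1) = (m + 1).ascFactorial (r + 1) :=
      (Nat.ascFactorial_eq_factorial_mul_choose m (r + 1)).symm
    have h2 : M ^ (r + 1) ≤ (m + 1).ascFactorial (r + 1) := Nat.pow_succ_le_ascFactorial _ _
    -- `(r+1)! · C(δm + c + r + 1, r + 1) = (δm+c+1)⋯(δm+c+r+1) ≤ (δm + c + r + 1)^{r+1}`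
    have h3 : (r + 1).factorial * (δ * m + c + (r + 1)).choose (r + 1) =
        (δ * m + c + 1).ascFactorial (r + 1) :=
      (Nat.ascFactorial_eq_factorial_mul_choose (δ * m + c) (r + 1)).symm
    have h4 : (δ * m + c + 1).ascFactorial (r + 1) ≤ (δ * m + c + (r + 1)) ^ (r + 1) :=
      Nat.ascFactorial_le_pow_add _ _
    have h5 : δ * m + c + (r + 1) ≤ δ * M + c' := by
      rw [hM, hc']
      nlinarith
    have h6 := pow_add_le_pow_add_mul (δ * M) c' r
    have h7 : (δ * M) ^ (r + 1) ≤ e * M ^ (r + 1) := by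
      rw [mul_pow]
      exact Nat.mul_le_mul_right _ he
    -- the error term is `< M^{r+1}`
    have hc'M : c' ≤ M := by
      rw [hM, hm]
      omega
    have hM1 : (r + 1) * c' * (δ + 1) ^ r < M := by
      rw [hM, hm]
      omega
    have h8 : (r + 1) * c' * (δ * M + c') ^ r < M ^ (r + 1) := by
      have hb : δ * M + c' ≤ (δ + 1) * M := by nlinarith
      calc (r + 1) * c' * (δ * M + c') ^ r ≤ (r + 1) * c' * ((δ + 1) * M) ^ r :=
            Nat.mul_le_mul_left _ (Nat.pow_le_pow_left hb r)
        _ = ((r + 1) * c' * (δ + 1) ^ r) * M ^ r := by rw [mul_pow]; ring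
        _ < M * M ^ r := Nat.mul_lt_mul_of_pos_right hM1 (pow_pos (by omega) r)
        _ = M ^ (r + 1) := by ring
    -- assemble, then cancel `(r+1)!`
    have key : (r + 1).factorial * (δ * m + c + (r + 1)).choose (r + 1) <
        (r + 1).factorial * ((e + 1) * (m + (r + 1)).choose (r + 1)) := by
      calc (r + 1).factorial * (δ * m + c + (r + 1)).choose (r + 1)
            ≤ (δ * m + c + (r + 1)) ^ (r + 1) := by rw [h3]; exact h4
        _ ≤ (δ * M + c') ^ (r + 1) := Nat.pow_le_pow_left h5 _
        _ ≤ (δ * M) ^ (r + 1) + (r + 1) * c' * (δ * M + c') ^ r := h6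
        _ < e * M ^ (r + 1) + M ^ (r + 1) := add_lt_add_of_le_of_lt h7 h8
        _ = (e + 1) * M ^ (r + 1) := by ring
        _ ≤ (e + 1) * (m + 1).ascFactorial (r + 1) := Nat.mul_le_mul_left _ h2
        _ = (r + 1).factorial * ((e + 1) * (m + (r + 1)).choose (r + 1)) := by
            rw [← h1]; ring
    have := Nat.lt_of_mul_lt_mul_left key
    simpa [Nat.add_assoc] using this

/-! ### Counting monomials (stars and bars) -/

/-- `#{b : Fin k → ℕ | Σ b ≤ n} = C(n + k, k)`: append the slack `n − Σ b` as a last coordinate to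
get the `(k+1)`-tuples of sum exactly `n` (`Finset.Nat.antidiagonalTuple`, counted in
`Literature.Combinatorics.Enumerative.card_antidiagonalTuple_succ`). [folklore] -/
private theorem card_tuple_sum_le (k n : ℕ) :
    Nat.card {b : Fin k → ℕ // ∑ i, b i ≤ n} = (n + k).choose k := by
  classical
  let e : {b : Fin k → ℕ // ∑ i, b i ≤ n} ≃ (Finset.Nat.antidiagonalTuple (k + 1) n) :=
    { toFun := fun b => ⟨Fin.snoc b.1 (n - ∑ i, b.1 i), by
        have hb := b.2
        rw [Finset.Nat.mem_antidiagonalTuple, Fin.sum_univ_castSucc]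
        simp only [Fin.snoc_castSucc, Fin.snoc_last]
        omega⟩
      invFun := fun c => ⟨fun i => c.1 (Fin.castSucc i), by
        have h := Finset.Nat.mem_antidiagonalTuple.1 c.2
        rw [Fin.sum_univ_castSucc] at h
        show ∑ i, c.1 (Fin.castSucc i) ≤ n
        omega⟩
      left_inv := fun b => by
        apply Subtype.ext
        funext i
        simp [Fin.snoc_castSucc]
      right_inv := fun c => by
        apply Subtype.ext
        funext j
        refine Fin.lastCases ?_ (fun i => ?_) j
        · have h := Finset.Nat.mem_antidiagonalTuple.1 c.2
          rw [Fin.sum_univ_castSucc] at h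
          simp only [Fin.snoc_last]
          omega
        · simp [Fin.snoc_castSucc] }
  rw [Nat.card_congr e, Nat.card_eq_fintype_card, Fintype.card_coe,
    Literature.Combinatorics.Enumerative.card_antidiagonalTuple_succ]

/-- The same count for any finite index type. [folklore] -/
private theorem card_fun_sum_le (ι : Type*) [Fintype ι] (n : ℕ) :
    Nat.card {b : ι → ℕ // ∑ i, b i ≤ n} = (n + Fintype.card ι).choose (Fintype.card ι) := by
  classical
  let eι := Fintype.equivFin ι
  let e : {b : ι → ℕ // ∑ i, b i ≤ n} ≃ {b : Fin (Fintype.card ι) → ℕ // ∑ i, b i ≤ n} :=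
    Equiv.subtypeEquiv (Equiv.arrowCongr eι (Equiv.refl ℕ)) fun b => by
      have hs : ∑ i, b i = ∑ j, (Equiv.arrowCongr eι (Equiv.refl ℕ)) b j := by
        rw [← Equiv.sum_comp eι.symm]
        rfl
      rw [hs]
  rw [Nat.card_congr e, card_tuple_sum_le]

/-- The monomials of total degree `≤ n` in the variables `ι`: `C(n + #ι, #ι)` of them. [folklore] -/
private theorem card_totalDegreeIndexSet (ι : Type*) [Fintype ι] (n : ℕ) :
    Nat.card {d : ι →₀ ℕ | (d.sum fun _ e => e) ≤ n} =
      (n + Fintype.card ι).choose (Fintype.card ι) := by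
  classical
  let e : {d : ι →₀ ℕ | (d.sum fun _ e => e) ≤ n} ≃ {b : ι → ℕ // ∑ i, b i ≤ n} :=
    Equiv.subtypeEquiv Finsupp.equivFunOnFinite fun d => by
      simp only [Set.mem_setOf_eq, Finsupp.equivFunOnFinite_apply]
      rw [Finsupp.sum_fintype _ _ (by simp)]
  rw [Nat.card_congr e, card_fun_sum_le]

/-- The monomials `y_0^a y^b` (`y` indexed by `σ`) with `a ≤ e` and `|b| ≤ m`:
`(e + 1)·C(m + #σ, #σ)` of them. [folklore] -/
private theorem card_optionIndexSet (σ : Type*) [Fintype σ] (e m : ℕ) :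
    Nat.card {D : Option σ →₀ ℕ | D none ≤ e ∧ ∑ j, D (some j) ≤ m} =
      (e + 1) * (m + Fintype.card σ).choose (Fintype.card σ) := by
  classical
  let e1 : {D : Option σ →₀ ℕ | D none ≤ e ∧ ∑ j, D (some j) ≤ m} ≃
      {F : Option σ → ℕ // F none ≤ e ∧ ∑ j, F (some j) ≤ m} :=
    Equiv.subtypeEquiv Finsupp.equivFunOnFinite fun D => by
      simp only [Set.mem_setOf_eq, Finsupp.equivFunOnFinite_apply]
  let e2 : {F : Option σ → ℕ // F none ≤ e ∧ ∑ j, F (some j) ≤ m} ≃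
      {a : ℕ // a ≤ e} × {b : σ → ℕ // ∑ j, b j ≤ m} :=
    { toFun := fun F => (⟨F.1 none, F.2.1⟩, ⟨fun j => F.1 (some j), F.2.2⟩)
      invFun := fun p => ⟨fun o => o.elim p.1.1 (fun j => p.2.1 j), p.1.2, p.2.2⟩
      left_inv := fun F => by
        apply Subtype.ext
        funext o
        cases o <;> rfl
      right_inv := fun p => rfl }
  let e4 : {a : ℕ // a ≤ e} ≃ Fin (e + 1) :=
    (Equiv.subtypeEquivRight fun a => Nat.lt_succ_iff.symm).trans Fin.equivSubtype.symm
  rw [Nat.card_congr e1, Nat.card_congr e2, Nat.card_prod, Nat.card_congr e4,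
    Nat.card_eq_fintype_card, Fintype.card_fin, card_fun_sum_le]

/-! ### The dimension count -/

variable {A : Type*} [CommRing A] {σ : Type*} [Fintype σ]

/-- A polynomial supported on the monomials `y_0^a y^b`, `a ≤ e`, `|b| ≤ m`, has total degree
`≤ e + m` and `y_0`-degree `≤ e`. [folklore] -/
private theorem totalDegree_le_of_mem_restrictSupport {e m : ℕ} {P : MvPolynomial (Option σ) A}
    (hP : P ∈ restrictSupport A {D : Option σ →₀ ℕ | D none ≤ e ∧ ∑ j, D (some j) ≤ m}) :
    P.totalDegree ≤ e + m ∧ degreeOf none P ≤ e := by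
  classical
  rw [restrictSupport, AddMonoidAlgebra.mem_supported] at hP
  refine ⟨?_, ?_⟩
  · rw [totalDegree, Finset.sup_le_iff]
    intro D hD
    have h := hP hD
    simp only [Set.mem_setOf_eq] at h
    rw [Finsupp.sum_fintype _ _ (by simp), Fintype.sum_option]
    omega
  · rw [degreeOf_le_iff]
    intro D hD
    have h := hP hD
    exact h.1

/-- **Perron's theorem for a coordinate, `y_0`-degree form ([BMS13] Thm. 4 as used in the proof
of Thm. 6), PROVED by a dimension count.** For `f_1, …, f_n ∈ A[x_1, …, x_n]` of total degree
`≤ δ` (`δ ≥ 1`, `A` any non-trivial commutative ring of coefficients) and any coordinate `x_i`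
there is a non-zero `F ∈ A[y_0, y_1, …, y_n]` with `F(x_i, f_1, …, f_n) = 0` and
`deg_{y_0} F ≤ δ^n`. Printed (Thm. 4, for `n+1` polynomials of degrees `δ_i ≥ 1` in `n` variables
over a field): a non-zero relation `F` with `deg(F) ≤ (∏ δ_i)/min δ_i`; App. A applies it to
`x_i, f_1, …, f_r, x_{r+1}, …, x_n` («with `(n−r+1)` of the `δ_i`'s being `1`, we have
`deg(F_i) ≤ δ^r`»). Typed: the `y_0`-DEGREE consequence of that bound (weaker than print), with the
untouched coordinates `x_{r+1}, …, x_n` allowed in the coefficient ring `A` — exactly what the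
Jacobian-criterion argument consumes (`∂_{y_0} F ≠ 0` when `char > δ^r`).
[cite: BeeckenMittmannSaxena2013, Thm. 4 (Perron) and App. A, proof of Thm. 6]
locator: paper:arxiv-1102.2789 p0005.txt:L31–L36; p0014.txt:L81–L84 -/
theorem exists_relation_degreeOf_le_pow [Nontrivial A] {δ : ℕ} (hδ : 1 ≤ δ)
    (f : σ → MvPolynomial σ A)
    (hf : ∀ j, (f j).totalDegree ≤ δ) (i : σ) :
    ∃ F : MvPolynomial (Option σ) A, F ≠ 0 ∧
      aeval (fun o : Option σ => o.elim (X i) f) F = 0 ∧ degreeOf none F ≤ δ ^ Fintype.card σ := by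
  classical
  set r := Fintype.card σ with hr
  set e := δ ^ r with he
  obtain ⟨m, hm⟩ := exists_choose_lt (c := δ * e) r hδ (le_refl e)
  set SV : Set (Option σ →₀ ℕ) := {D | D none ≤ e ∧ ∑ j, D (some j) ≤ m} with hSV
  set V := restrictSupport A SV with hV
  set W := restrictTotalDegree σ A ((e + m) * δ) with hW
  set g : Option σ → MvPolynomial σ A := fun o => o.elim (X i) f with hg
  have hgdeg : ∀ o, (g o).totalDegree ≤ δ := by
    rintro (_ | j)
    · simp only [hg, Option.elim_none, totalDegree_X]
      exact hδ
    · exact hf j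
  -- `F ↦ F(x_i, f)` maps `V` into `W`
  have hmap : ∀ P : MvPolynomial (Option σ) A, P ∈ V → aeval g P ∈ W := by
    intro P hP
    rw [hW, mem_restrictTotalDegree]
    calc (aeval g P).totalDegree ≤ P.totalDegree * δ := totalDegree_aeval_le g hgdeg P
      _ ≤ (e + m) * δ := Nat.mul_le_mul_right _ (totalDegree_le_of_mem_restrictSupport hP).1
  let φ : V →ₗ[A] W :=
    LinearMap.codRestrict W ((aeval g).toLinearMap.comp V.subtype) fun P => hmap P.1 P.2
  -- ranks
  have hVrank : finrank A V = (e + 1) * (m + r).choose r := by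
    rw [hV, finrank_eq_nat_card_basis (basisRestrictSupport A SV), hSV, card_optionIndexSet]
  have hWcard : Nat.card {d : σ →₀ ℕ | (d.sum fun _ e => e) ≤ (e + m) * δ} =
      ((e + m) * δ + r).choose r := card_totalDegreeIndexSet σ _
  have hWfin : Module.Finite A W := by
    haveI : Finite {d : σ →₀ ℕ | (d.sum fun _ e => e) ≤ (e + m) * δ} :=
      Nat.finite_of_card_ne_zero (by rw [hWcard]; exact (Nat.choose_pos (Nat.le_add_left _ _)).ne')
    exact Module.Finite.of_basis (basisRestrictSupport A _)
  have hWrank : finrank A W = ((e + m) * δ + r).choose r := by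
    rw [hW, restrictTotalDegree, finrank_eq_nat_card_basis (basisRestrictSupport A _), hWcard]
  have hlt : finrank A W < finrank A V := by
    rw [hWrank, hVrank]
    have : (e + m) * δ + r = δ * m + δ * e + r := by ring
    rw [this]
    exact hm
  -- so `φ` is not injective
  have hninj : ¬ Function.Injective φ := fun hinj =>
    absurd (LinearMap.finrank_le_finrank_of_injective hinj) (not_le.2 hlt)
  rw [injective_iff_map_eq_zero] at hninj
  obtain ⟨P, hP⟩ := not_forall.1 hninj
  obtain ⟨hP0, hPne⟩ := Classical.not_imp.1 hP
  refine ⟨P.1, fun h => hPne (Subtype.ext h), ?_, (totalDegree_le_of_mem_restrictSupport P.2).2⟩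
  have := congrArg Subtype.val hP0
  simpa [φ] using this

/-! ### The same with the untouched coordinates as variables (the shape of [BMS13] App. A) -/

section SumForm

variable {K : Type*} [CommRing K] {S₁ S₂ : Type*}

/-- The "flattening" `A[x_{S₂}][y_{S₁}] ≅ A[y_{S₁} ⊔ x_{S₂}]` does not raise the total degree in the
`S₁`-variables: `deg (sumAlgEquiv p) ≤ deg p`. [folklore] -/
private theorem totalDegree_sumAlgEquiv_le [Nontrivial K] (p : MvPolynomial (S₁ ⊕ S₂) K) :
    (sumAlgEquiv K S₁ S₂ p).totalDegree ≤ p.totalDegree := by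
  classical
  set ι := sumAlgEquiv K S₁ S₂ with hι
  conv_lhs => rw [p.as_sum, map_sum]
  refine totalDegree_finsetSum_le fun d hd => ?_
  have hX : ∀ v : S₁ ⊕ S₂, (ι (X v)).totalDegree ≤ 1 := by
    rintro (a | b)
    · rw [hι, sumAlgEquiv_X_inl, totalDegree_X]
    · rw [hι, sumAlgEquiv_X_inr, totalDegree_C]
      exact Nat.zero_le _
  rw [monomial_eq, map_mul, Finsupp.prod, map_prod]
  refine (totalDegree_mul _ _).trans ?_
  rw [hι, sumAlgEquiv_C_inl, totalDegree_C, zero_add, ← hι]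
  refine (totalDegree_finsetProd _ _).trans ?_
  calc ∑ v ∈ d.support, (ι (X v ^ d v)).totalDegree
        ≤ ∑ v ∈ d.support, d v := by
        refine Finset.sum_le_sum fun v _ => ?_
        rw [map_pow]
        refine (totalDegree_pow _ _).trans ?_
        calc d v * (ι (X v)).totalDegree ≤ d v * 1 := Nat.mul_le_mul_left _ (hX v)
          _ = d v := mul_one _
    _ = d.sum (fun _ e => e) := rfl
    _ ≤ p.totalDegree := le_totalDegree hd

/-- Coefficients from `K[x_{S₂}]` do not involve the `S₁`-variables after flattening: the
`y_{inl s}`-degree of `(sumAlgEquiv)⁻¹ (C c)` is `0`. [folklore] -/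
private theorem degreeOf_inl_sumAlgEquiv_symm_C [Nontrivial K] (s : S₁) (c : MvPolynomial S₂ K) :
    degreeOf (Sum.inl s) ((sumAlgEquiv K S₁ S₂).symm (C c)) = 0 := by
  classical
  induction c using MvPolynomial.induction_on with
  | C a =>
    rw [sumAlgEquiv_symm_C_C, degreeOf_C]
  | add p q hp hq =>
    rw [map_add, map_add]
    have h := degreeOf_add_le (Sum.inl s : S₁ ⊕ S₂) ((sumAlgEquiv K S₁ S₂).symm (C p))
      ((sumAlgEquiv K S₁ S₂).symm (C q))
    rw [hp, hq, max_self] at h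
    exact Nat.le_zero.1 h
  | mul_X p t hp =>
    rw [map_mul, map_mul, sumAlgEquiv_symm_C_X]
    have h := degreeOf_mul_le (Sum.inl s : S₁ ⊕ S₂) ((sumAlgEquiv K S₁ S₂).symm (C p))
      (X (Sum.inr t))
    rw [hp, degreeOf_X, if_neg Sum.inl_ne_inr, add_zero] at h
    exact Nat.le_zero.1 h

/-- … hence the `y_{inl s}`-degree of `(sumAlgEquiv)⁻¹ Q` is at most the `y_s`-degree of `Q`.
[folklore] -/
private theorem degreeOf_inl_sumAlgEquiv_symm_le [Nontrivial K] (s : S₁)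
    (Q : MvPolynomial S₁ (MvPolynomial S₂ K)) :
    degreeOf (Sum.inl s) ((sumAlgEquiv K S₁ S₂).symm Q) ≤ degreeOf s Q := by
  classical
  set κ := (sumAlgEquiv K S₁ S₂).symm with hκ
  conv_lhs => rw [Q.as_sum, map_sum]
  refine (degreeOf_sum_le _ _ _).trans (Finset.sup_le fun d hd => ?_)
  rw [monomial_eq, map_mul, Finsupp.prod, map_prod]
  refine (degreeOf_mul_le _ _ _).trans ?_
  rw [hκ, degreeOf_inl_sumAlgEquiv_symm_C, zero_add, ← hκ]
  refine (degreeOf_prod_le _ _ _).trans ?_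
  calc ∑ v ∈ d.support, degreeOf (Sum.inl s) (κ (X v ^ d v))
        ≤ ∑ v ∈ d.support, (if s = v then d v else 0) := by
        refine Finset.sum_le_sum fun v _ => ?_
        rw [map_pow, hκ, sumAlgEquiv_symm_X]
        refine (degreeOf_pow_le _ _ _).trans ?_
        rw [degreeOf_X]
        by_cases h : s = v
        · subst h
          simp
        · rw [if_neg (fun h' => h (Sum.inl_injective h')), if_neg h, mul_zero]
    _ ≤ d s := by
        rw [Finset.sum_ite_eq]
        split_ifs <;> simp
    _ ≤ degreeOf s Q := monomial_le_degreeOf s hd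

variable {σ τ : Type*} [Fintype σ]

/-- **Perron's theorem for a coordinate, `y_0`-degree form — the shape of [BMS13] App. A.** For
`f_1, …, f_r ∈ K[x_σ, x_τ]` (`|σ| = r`) of total degree `≤ δ` (`δ ≥ 1`) and a coordinate `x_i`,
`i ∈ σ`, there is a non-zero `H ∈ K[y_0, y_σ, y_τ]` with
`H(x_i, (f_j)_{j ∈ σ}, (x_t)_{t ∈ τ}) = 0` and `deg_{y_0} H ≤ δ^r` — print: «`F_i ∈ K[y_0, …, y_n]` …
`F_i(x_i, f_1, …, f_r, x_{r+1}, …, x_n) = 0`. By Theorem 4 (with `(n−r+1)` of the `δ_i`'s being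
`1`), we have `deg(F_i) ≤ δ^r`» (the total degree in print; the `y_0`-degree typed, which is what
«hence `∂_{y_0}F_i ≠ 0`» uses). From `exists_relation_degreeOf_le_pow` over the coefficient ring
`A = K[x_τ]`, transported along `K[x_σ, x_τ] ≅ A[x_σ]` (`MvPolynomial.sumAlgEquiv`).
[cite: BeeckenMittmannSaxena2013, Thm. 4 (Perron) and App. A, proof of Thm. 6]
locator: paper:arxiv-1102.2789 p0005.txt:L31–L36; p0014.txt:L74–L84 -/
theorem exists_relation_degreeOf_le_pow_sum [Nontrivial K] {δ : ℕ} (hδ : 1 ≤ δ)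
    (f : σ → MvPolynomial (σ ⊕ τ) K) (hf : ∀ j, (f j).totalDegree ≤ δ) (i : σ) :
    ∃ H : MvPolynomial (Option (σ ⊕ τ)) K, H ≠ 0 ∧
      aeval (fun o : Option (σ ⊕ τ) =>
        o.elim (X (Sum.inl i)) (Sum.elim f fun t => X (Sum.inr t))) H = 0 ∧
      degreeOf none H ≤ δ ^ Fintype.card σ := by
  classical
  set ι := sumAlgEquiv K σ τ with hι
  set f' : σ → MvPolynomial σ (MvPolynomial τ K) := fun j => ι (f j) with hf'
  have hf'deg : ∀ j, (f' j).totalDegree ≤ δ := fun j =>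
    (totalDegree_sumAlgEquiv_le (f j)).trans (hf j)
  obtain ⟨F, hF0, hF, hFdeg⟩ := exists_relation_degreeOf_le_pow hδ f' hf'deg i
  set ι₂ := sumAlgEquiv K (Option σ) τ with hι₂
  set G := ι₂.symm F with hG
  -- the re-indexing `Option σ ⊕ τ → Option (σ ⊕ τ)`
  set κ : Option σ ⊕ τ → Option (σ ⊕ τ) :=
    Sum.elim (Option.map Sum.inl) (fun t => some (Sum.inr t)) with hκ
  have hκinj : Function.Injective κ := by
    refine Function.LeftInverse.injective (g := fun o : Option (σ ⊕ τ) =>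
      o.elim (Sum.inl none) (Sum.elim (fun s => Sum.inl (some s)) fun t => Sum.inr t)) ?_
    intro v
    rcases v with (_ | a) | b <;> rfl
  refine ⟨rename κ G, ?_, ?_, ?_⟩
  · -- non-zero
    intro h0
    apply hF0
    have hG0 : G = 0 := rename_injective κ hκinj (by rw [h0, map_zero])
    rw [hG] at hG0
    simpa using congrArg ι₂ hG0
  · -- the relation
    set g₂ : Option σ ⊕ τ → MvPolynomial (σ ⊕ τ) K :=
      Sum.elim (fun o : Option σ => o.elim (X (Sum.inl i)) f) (fun t => X (Sum.inr t)) with hg₂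
    have hcomp : (fun o : Option (σ ⊕ τ) =>
        o.elim (X (Sum.inl i)) (Sum.elim f fun t => X (Sum.inr t))) ∘ κ = g₂ := by
      funext v
      rcases v with (_ | a) | b <;> rfl
    rw [aeval_rename, hcomp]
    -- `ι ∘ aeval g₂ = aeval_A (x_i, f') ∘ ι₂` as `K`-algebra maps
    have hext : ι.toAlgHom.comp (aeval g₂) =
        ((aeval fun o : Option σ => o.elim (X i) f').restrictScalars K).comp ι₂.toAlgHom := by
      refine MvPolynomial.algHom_ext fun v => ?_
      rcases v with (_ | a) | b
      · simp [hg₂, hι, hι₂, sumAlgEquiv_X_inl]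
      · simp [hg₂, hι, hι₂, hf', sumAlgEquiv_X_inl]
      · simp [hg₂, hι, hι₂, sumAlgEquiv_X_inr]
    have h1 := congrArg (fun φ : MvPolynomial (Option σ ⊕ τ) K →ₐ[K]
        MvPolynomial σ (MvPolynomial τ K) => φ G) hext
    have h1' : ι (aeval g₂ G) = aeval (fun o : Option σ => o.elim (X i) f') F := by
      simpa [hG] using h1
    rw [hF] at h1'
    -- `ι (aeval g₂ G) = 0`
    apply ι.injective
    rw [map_zero]
    exact h1'
  · -- the `y_0`-degree
    have h := degreeOf_rename_of_injective hκinj (Sum.inl none : Option σ ⊕ τ) (p := G)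
    have hκ0 : κ (Sum.inl none) = none := rfl
    rw [hκ0] at h
    rw [h, hG, hι₂]
    exact (degreeOf_inl_sumAlgEquiv_symm_le none F).trans hFdeg

end SumForm

end Literature.RingTheory.Nullstellensatz

end
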